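/-
Copyright (c) 2026 the pub-hodgecm-mathlib formalisation cell (harness21).  Prover seat hodgecm-mathlib-LH7-p07 (g2) on the CHAIR K2-lead VALVE,
Track B «K2-LIT» ∕ hLiu418 #184♮ = `stmt-HodgeConjecture-24832`, Road I v3 U5 «THE CLOSE» — FACE-G organ (G-gen) = F4, road (E), brick (E-d-P) arch half
(P-arch) (LEAD F0P6-plan (g14) BATCH #142 (1); F4 lead K2Liu-p27 (g2); box K2E5-r02 (g6)).  THEOREMS ONLY.
-/
import Summits.HodgeConjecture.HodgeConjecture.Theorems.K2LiuArchWeilJunctionTransport     -- ★ J2c (left leg) + ★ (W4) `exists_clm_swSection_tmul_mul_archEmb_placeSecJ`, ★ `archSectionRepJ_placeSecJ_inl_tensorPi`, ★ see-saw file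
import Literature.RepresentationTheory.KonnoKonno2007.JunctionSmoothOneParameter            -- ★ `κOp`, `weilDatum_apply_κ_eq_κOp`
import HarnessLib

/-!
# Crux `HLiu418`, FACE-G organ (G-gen), road (E), brick (E-d-P) arch half (P-arch): THE RIGHT LEG (AND EVERY PAIR ELEMENT) AT ONE REAL PLACE READS THE
# JUNCTION WEIL REPRESENTATION — `f_{a ⊗ f}(H′ · (g_V ⊗ g_W)_σ) = η · ℓ′((e_* ω_{P,Q,R,S}(g_V, g_W) Φ₁) ⊠ Φ₂)`, and on `1 × K_H` the junction operator IS `κOp R S e (1,k)`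

Cell `hodgecm-mathlib`, crux item hLiu418 = `stmt-HodgeConjecture-24832`; squad K2 ∕ K2Liu, F4 lead K2Liu-p27 (g2); prover LH7-p07 (g2).  THEOREMS ONLY
(no `def`, no instance, no notation, no named-fact hypothesis, no `sorry`); lane `--supports stmt-HodgeConjecture-24832 --as helper`.

WHY ((E-d) PIVOT «`SW_σ(κOp (1,k′) v) = vacScalar • SW_σ v`», MEMO `MEMO-F4-E-Interface` §1 (E-d) (ii)).  ★ J2c `K2LiuArchWeilJunctionTransport.exists_clm_swSectionTensor_mul_oneplace_eq`
reads the Siegel–Weil section of the BIG datum `𝔻 ⊗ V′` along the LEFT leg `h ↦ h ⊗ 1_{V′}` at a real place `σ` through the junction Weil representation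
`ω_{P,Q,R,S} = weilRep ∘ toBig` of the pair `U(𝔻_σ) × U(V′_σ) = U(P,Q) × U(R,S)` at `(h, 1)`.  The (E-d) pivot needs the RIGHT leg `k′ ↦ 1_𝔻 ⊗ k′`: in Konno–Konno's
sorted block index of `𝕎_σ = 𝔻_σ ⊗ V′_σ` the element `g_V ⊗ g_W` IS `toBig P Q R S (g_V, g_W) ∈ U(P_𝕎, Q_𝕎)` for EVERY pair element, so the three ★ inputs of J2c
— (W4) `exists_clm_swSection_tmul_mul_archEmb_placeSecJ` (any `u ∈ U(P_𝕎,Q_𝕎) × U(1,0)`), `archSectionRepJ_placeSecJ_inl_tensorPi` (any `g ∈ U(P_𝕎,Q_𝕎)`, χ pinned),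
and the see-saw — apply verbatim once the see-saw is stated for a GENERAL pair element (★ `weilRepPair_unit_toBig_inl` is the case `(h, 1)`):
* §1 **`weilHomV_unit_toBig`**, `weilHomV_unit_toBig_apply`, **`weilRepPair_unit_toBig`** — `(weilRep ∘ toBig P_𝕎 Q_𝕎 1 ∅) (toBig P Q R S g, 1) (e_* f) = e_* (ω_{P,Q,R,S} g f)`
  for EVERY `g ∈ U(P,Q) × U(R,S)` (★ `toBig_inl_one`, ★ `weilElt_relabel`, ★ `MpS.reindex_apply_schwartzTransport`);
* §2 **`weilRepPair_κ_eq_κOp`** — on the maximal compact `K̃ × K_H`, `ω_{P,Q,R,S}(κ k) = κOp R S e k` with Konno–Konno's base exponents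
  `e = ⟨−|S|, −|R|, −|Q|, −|P|⟩` (★ `weilDatum_apply_κ_eq_κOp` ∘ ★ `isArchWeilDatum_weilRepPair` ∘ ★ `weilRepPair_κ_hermitePi_zero`);
* §3 **`exists_clm_swSection_mul_placeSecJ_pair_eq`** — at the big datum `(e′, dV, tensorFrame dW eW dV′)`, for a `χ`-normalised `sB`, `f`, `H′ ∈ H_big(𝔸)`: ONE continuous
  linear functional `ℓ′` with, for ALL `g ∈ U(P,Q) × U(R,S)`, `Φ₁`, `Φ₂`, `a` with `𝒥 a = (e_* Φ₁) ⊠ Φ₂`: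
  `swSection sB (E(a ⊗ f)) (H′ · archEmb (placeSecJ_𝕎 σ (toBig P Q R S g, 1))) = η_t(placeSecJ_𝕎 σ (toBig g, 1)) · ℓ′((e_* (ω_{P,Q,R,S} g Φ₁)) ⊠ Φ₂)` — both legs at once;
* §4 **`exists_clm_swSection_mul_placeSecJ_kH_eq`** — the RIGHT LEG ON `K_H = U(R) × U(S)`: the same at `g = κ(1, k)` with `κOp R S e (1, k) Φ₁` in the slot (§2).
So for the pivot: `SW_σ(κOp (1,k) Φ₁) := ℓ′((e_* (κOp (1,k) Φ₁)) ⊠ Φ₂)` is, up to `η_t`, the big section at `H′ · (1 ⊗ k)_σ`, which the Siegel-Levi invariance of (P-adelic)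
(`K2LiuSWSectionRightLegInvariance`, K2Liu-p03: `1 ⊗ k′ ∈ P_Δ`) turns into a character times the section at `H′`; the group identity «`tensorEmbRight` at `σ` =
`archEmb ∘ placeSecJ_𝕎 σ ∘ toBig (1, ·)`» is (P-adelic)'s `tensorEmb_archToAdelic` twin.  References: [KonnoKonno2007] §3.1 (3.1), §3.3 p. 47, Lemma 5.2;
[Kudla1984] §1 (see-saw); [Folland1989] Prop. (1.43), §4.2 (4.23), Prop. (4.39); [Weil1964] Chap. III n° 37–39; [KudlaRallis1994] §1; [GelbartRogawski1991] §3.1 Prop. 3.1.1.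
HONEST LABEL.  Count-neutral helper: `HC_CM` is proved only modulo the 7 printed citations (2 remaining named inputs: hLiu418 = `stmt-HodgeConjecture-24832`,
h413 = `stmt-HodgeConjecture-24833`) until rung 0 closes; this file closes no socket.
-/

set_option autoImplicit false
set_option linter.dupNamespace false -- the mandated namespace repeats `HodgeConjecture.HodgeConjecture`
set_option synthInstance.maxSize 512 -- `DecidableEq` of the nested block index `DPIdx ((P×R)⊕(Q×S)) ((P×S)⊕(Q×R)) Unit Empty` (structural; as ★ `K2LiuWeilSeesawRelabel`)

noncomputable section

open scoped Classical Matrix TensorProduct Kronecker SchwartzMap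
open NumberField NumberField.InfinitePlace NumberField.mixedEmbedding IsDedekindDomain
open Literature.Analysis.SegalBargmann Literature.RepresentationTheory.HeisenbergGroup
open Literature.NumberTheory.Automorphic Literature.NumberTheory.Automorphic.UnitaryGroup Literature.NumberTheory.GaloisRepresentations
open Literature.NumberTheory.Weil1964 Literature.NumberTheory.Weil1964.MpS Literature.NumberTheory.Weil1964.UnitaryWeil
open Literature.RepresentationTheory.HarrisKudlaSweet1996
open Literature.RepresentationTheory.KonnoKonno2007 Literature.RepresentationTheory.KonnoKonno2007.RealDualPair
open Literature.NumberTheory.GelbartRogawski1991 Literature.NumberTheory.GelbartRogawski1991.GRConstruction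
open Literature.NumberTheory.GelbartRogawski1991.UnitaryDualPair
open Literature.NumberTheory.GelbartRogawski1991.UnitaryDualPair.LocalSplitting
open Literature.NumberTheory.K2Lit.SiegelDoubled
open Summit.HodgeConjecture.HodgeConjecture.Cruxes.HLiu418.K2LiuArchSectionPlaceBlock
open Summit.HodgeConjecture.HodgeConjecture.Cruxes.HLiu418 (K2LiuArchOneParameterOrbitDefs.archEmb)
open Summit.HodgeConjecture.HodgeConjecture.Cruxes.HLiu418.K2LiuSwSectionArchOrbit
open Summit.HodgeConjecture.HodgeConjecture.Cruxes.HLiu418.K2LiuWeilSeesawRelabel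

open Summit.HodgeConjecture.HodgeConjecture.Cruxes.HLiu418.K2LiuArchWeilJunctionTransport

namespace Summit.HodgeConjecture.HodgeConjecture.Cruxes.HLiu418.K2LiuArchRightLegPlacePin

/-! ## §1 The see-saw for a GENERAL pair element -/

section Seesaw

variable {P Q R S : Type} [Fintype P] [DecidableEq P] [Fintype Q] [DecidableEq Q] [Fintype R] [DecidableEq R] [Fintype S] [DecidableEq S]

/-- **THE SEE-SAW (element form), every pair element**: `weilHomV P_𝕎 Q_𝕎 1 ∅ (toBig P Q R S g) = MpS.reindex (unitJunctionIdx P_𝕎 Q_𝕎)⁻¹ (weilElt (toBig P Q R S g))`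
(★ `toBig_inl_one`: `(g_V ⊗ g_W) ⊗ 1₁` is the relabelling of `g_V ⊗ g_W`; ★ `weilElt_relabel`). [cite: KonnoKonno2007, §3.1 (3.1), §3.3 p. 47] [cite: Kudla1984, §1] -/
theorem weilHomV_unit_toBig (g : Ginf P Q R S) :
    weilHomV ((P × R) ⊕ (Q × S)) ((P × S) ⊕ (Q × R)) Unit Empty (toBig P Q R S g) =
      MpS.reindex (unitJunctionIdx ((P × R) ⊕ (Q × S)) ((P × S) ⊕ (Q × R))).symm (weilElt (toBig P Q R S g)) := by
  rw [weilHomV_apply, toBig_inl_one, weilElt_relabel]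
  rfl

/-- **THE SEE-SAW (operator form), every pair element**: `(weilHomV P_𝕎 Q_𝕎 1 ∅ (g_V ⊗ g_W)) (e_* f) = e_* ((weilElt (g_V ⊗ g_W)) f)`. [cite: KonnoKonno2007, §3.3 p. 47] -/
theorem weilHomV_unit_toBig_apply (g : Ginf P Q R S) (f : SchwartzMap (DPIdx P Q R S → ℝ) ℂ) :
    (weilHomV ((P × R) ⊕ (Q × S)) ((P × S) ⊕ (Q × R)) Unit Empty (toBig P Q R S g)).1.2
        (schwartzTransport (reindexCLE (unitJunctionIdx ((P × R) ⊕ (Q × S)) ((P × S) ⊕ (Q × R))).symm) f) =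
      schwartzTransport (reindexCLE (unitJunctionIdx ((P × R) ⊕ (Q × S)) ((P × S) ⊕ (Q × R))).symm) ((weilElt (toBig P Q R S g)).1.2 f) := by
  rw [weilHomV_unit_toBig, MpS.reindex_apply_schwartzTransport]

/-- **THE SEE-SAW in `weilRepPair` letters, every pair element**: the junction Weil representation of `U(𝕎) × U(1,0)` at `(g_V ⊗ g_W, 1)` on a relabelled vector is the
relabelled image of the junction Weil representation of `U(P,Q) × U(R,S)` at `(g_V, g_W)` (★ `weilRepPair_unit_toBig_inl` is `g_W = 1`).
[cite: KonnoKonno2007, §3.3 p. 47] [cite: Kudla1984, §1] -/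
theorem weilRepPair_unit_toBig (g : Ginf P Q R S) (f : SchwartzMap (DPIdx P Q R S → ℝ) ℂ) :
    (weilRep (α := (((P × R) ⊕ (Q × S)) × Unit) ⊕ (((P × S) ⊕ (Q × R)) × Empty))
          (β := (((P × R) ⊕ (Q × S)) × Empty) ⊕ (((P × S) ⊕ (Q × R)) × Unit))).comp
        (toBig ((P × R) ⊕ (Q × S)) ((P × S) ⊕ (Q × R)) Unit Empty)
        ((toBig P Q R S g, (1 : UForm Unit Empty)) : Ginf ((P × R) ⊕ (Q × S)) ((P × S) ⊕ (Q × R)) Unit Empty)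
        (schwartzTransport (reindexCLE (unitJunctionIdx ((P × R) ⊕ (Q × S)) ((P × S) ⊕ (Q × R))).symm) f) =
      schwartzTransport (reindexCLE (unitJunctionIdx ((P × R) ⊕ (Q × S)) ((P × S) ⊕ (Q × R))).symm)
        ((weilRep (α := (P × R) ⊕ (Q × S)) (β := (P × S) ⊕ (Q × R))).comp (toBig P Q R S) g f) := by
  rw [weilRepPair_inl, weilRepPair_apply]
  exact weilHomV_unit_toBig_apply g f

/-! ## §2 On the maximal compact the junction operator is `κOp` -/

/-- **`ω_{P,Q,R,S}(κ k) = κOp R S e k`** with Konno–Konno's base exponents `e = ⟨−|S|, −|R|, −|Q|, −|P|⟩` — in particular on the right-leg compact `1 × (U(R) × U(S))`.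
[cite: KonnoKonno2007, Lemma 5.2 p. 73] [cite: Folland1989, §4.2 Prop. (4.39)] -/
theorem weilRepPair_κ_eq_κOp (k : DPK P Q R S) (f : SchwartzMap (DPIdx P Q R S → ℝ) ℂ) :
    (weilRep (α := (P × R) ⊕ (Q × S)) (β := (P × S) ⊕ (Q × R))).comp (toBig P Q R S) (κ P Q R S k) f =
      κOp R S (⟨-(Fintype.card S : ℤ), -(Fintype.card R : ℤ), -(Fintype.card Q : ℤ), -(Fintype.card P : ℤ)⟩ : VacExponents) k f :=
  weilDatum_apply_κ_eq_κOp (isArchWeilDatum_weilRepPair P Q R S) weilRepPair_κ_hermitePi_zero k f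

end Seesaw

/-! ## §3 The big section along ANY pair element at `σ`, and §4 the right leg on `K_H` -/

section Pin

variable (L : Type) [Field L] [NumberField L] [IsCMField L]
variable {N M n : ℕ} (e : Fin N × Fin M ≃ Fin n)
  (dV : Fin N → L) (hdV : ∀ i, IsCMField.complexConj L (dV i) = dV i) (hdV0 : ∀ i, dV i ≠ 0)
  (dW : Fin M → L) (hdW : ∀ i, IsCMField.complexConj L (dW i) = dW i) (hdW0 : ∀ i, dW i ≠ 0)
variable {M₂ M' n' : ℕ} (eW : Fin M × Fin M₂ ≃ Fin M') (e' : Fin N × Fin M' ≃ Fin n')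
  (dV' : Fin M₂ → L) (hdV' : ∀ k, IsCMField.complexConj L (dV' k) = dV' k) (hdV'0 : ∀ k, dV' k ≠ 0)
variable (σ : {v : InfinitePlace (Fp L) // v.IsReal})
  {P Q R S : Type} [Fintype P] [DecidableEq P] [Fintype Q] [DecidableEq Q] [Fintype R] [DecidableEq R] [Fintype S] [DecidableEq S]
  (eP : PosIdx (signVec (cmPlaceOver L) (fun k => Sum.elim (cmGramEntry L e' dV hdV (tensorFrame L dW eW dV') (tensorFrame_real L dW hdW eW dV' hdV')) (-cmGramEntry L e' dV hdV (tensorFrame L dW eW dV') (tensorFrame_real L dW hdW eW dV' hdV')) ((LocalSplitting.e₂ n').symm k)) (imagUnit L) σ) ≃ (P × R) ⊕ (Q × S))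
  (eQ : NegIdx (signVec (cmPlaceOver L) (fun k => Sum.elim (cmGramEntry L e' dV hdV (tensorFrame L dW eW dV') (tensorFrame_real L dW hdW eW dV' hdV')) (-cmGramEntry L e' dV hdV (tensorFrame L dW eW dV') (tensorFrame_real L dW hdW eW dV' hdV')) ((LocalSplitting.e₂ n').symm k)) (imagUnit L) σ) ≃ (P × S) ⊕ (Q × R))


-- the doubled metaplectic carrier of the big datum and the CM sign frame elaborate slowly (as ★ J2c: 4 000 000 heartbeats for the statement)
set_option maxHeartbeats 4000000 in
include hdW0 in
/-- **THE SIEGEL–WEIL SECTION OF `𝔻 ⊗ V′` ALONG ANY PAIR ELEMENT AT ONE REAL PLACE** (both legs): for a `χ`-normalised doubled Weil representation `sB` of the big datum,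
a finite vector `f` and `H′ ∈ H_big(𝔸)`, ONE continuous linear functional `ℓ′` reads, for ALL `g = (g_V, g_W) ∈ U(P,Q) × U(R,S)`, `Φ₁`, `Φ₂`, `a` with `𝒥 a = (e_* Φ₁) ⊠ Φ₂`:
`swSection sB (E(a ⊗ f)) (H′ · archEmb (placeSecJ_𝕎 σ (toBig P Q R S g, 1))) = η_t(placeSecJ_𝕎 σ (toBig g, 1)) · ℓ′((e_* (ω_{P,Q,R,S} g Φ₁)) ⊠ Φ₂)` (★ (W4) + ★ pinned junction + §1).
[cite: KonnoKonno2007, §3.3 p. 47, Lemma 5.2] [cite: Folland1989, Prop. (1.43), §4.2 (4.23)] [cite: Kudla1984, §1] [cite: KudlaRallis1994, §1] [cite: Weil1964, Chap. III n° 37–39] -/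
theorem exists_clm_swSection_mul_placeSecJ_pair_eq {χ : HeckeCharacter L} (hχu : χ.IsUnitary) (hχs : IsSplittingChar L 1 χ)
    {sB : HA L e' dV hdV (tensorFrame L dW eW dV') (tensorFrame_real L dW hdW eW dV' hdV') →*
      MpD L e' dV hdV (tensorFrame L dW eW dV') (tensorFrame_real L dW hdW eW dV' hdV')}
    (hsB : IsDoubledWeilRep L e' dV hdV hdV0 (tensorFrame L dW eW dV') (tensorFrame_real L dW hdW eW dV' hdV')
      (tensorFrame_ne_zero L dW eW dV' hdW0 hdV'0) χ sB)
    {t : InfinitePlace L → ℤ} (ht : χ.HasUnitaryArchType t 0) (hodd : ∀ w, Odd (t w))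
    (H' : HA L e' dV hdV (tensorFrame L dW eW dV') (tensorFrame_real L dW hdW eW dV' hdV')) (f : FinSB (Fp L) (Fin (n' + n'))) :
    ∃ ℓ' : 𝓢(((DPIdx ((P × R) ⊕ (Q × S)) ((P × S) ⊕ (Q × R)) Unit Empty ⊕ (Fin (n' + n') × {v : {v : InfinitePlace (Fp L) // v.IsReal} // v ≠ σ})) → ℝ), ℂ) →L[ℂ] ℂ,
      ∀ (g : Ginf P Q R S) (Φ₁ : 𝓢((DPIdx P Q R S → ℝ), ℂ))
        (Φ₂ : 𝓢(((Fin (n' + n') × {v : {v : InfinitePlace (Fp L) // v.IsReal} // v ≠ σ}) → ℝ), ℂ))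
        (a : 𝓢((Fin (n' + n') → mixedSpace (Fp L)), ℂ)),
        ((((schwartzTransport
                  (scaledFrame (Fp L) (Fin (n' + n'))
                    (placeScale (n' + n') fun v => sqrtAbs (signVec (cmPlaceOver L)
                      (fun k => Sum.elim (cmGramEntry L e' dV hdV (tensorFrame L dW eW dV') (tensorFrame_real L dW hdW eW dV' hdV')) (-cmGramEntry L e' dV hdV (tensorFrame L dW eW dV') (tensorFrame_real L dW hdW eW dV' hdV')) ((LocalSplitting.e₂ n').symm k))
                      (imagUnit L) v))
                    (placeScale_ne_zero (n' + n') (sqrtAbs_signVec_ne_zero (IsCMField.complexConj_ne_one L) (cmPlaceOver_smul L)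
                      (complexConj_imagUnit L) (imagUnit_ne_zero L) (gramD_gram_realDiagonal_entry_ne_zero L e' dV hdV (tensorFrame L dW eW dV') (tensorFrame_real L dW hdW eW dV' hdV') hdV0 (tensorFrame_ne_zero L dW eW dV' hdW0 hdV'0)))))).trans
                (schwartzTransport (reindexCLE (placeSplitEquiv (signSplit (signVec (cmPlaceOver L)
                  (fun k => Sum.elim (cmGramEntry L e' dV hdV (tensorFrame L dW eW dV') (tensorFrame_real L dW hdW eW dV' hdV')) (-cmGramEntry L e' dV hdV (tensorFrame L dW eW dV') (tensorFrame_real L dW hdW eW dV' hdV')) ((LocalSplitting.e₂ n').symm k))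
                  (imagUnit L) σ)) σ)))).trans
                (schwartzTransport (reindexCLE (Equiv.sumCongr
                  (unitJunctionIdx
                    (PosIdx (signVec (cmPlaceOver L)
                      (fun k => Sum.elim (cmGramEntry L e' dV hdV (tensorFrame L dW eW dV') (tensorFrame_real L dW hdW eW dV' hdV')) (-cmGramEntry L e' dV hdV (tensorFrame L dW eW dV') (tensorFrame_real L dW hdW eW dV' hdV')) ((LocalSplitting.e₂ n').symm k))
                      (imagUnit L) σ))
                    (NegIdx (signVec (cmPlaceOver L)
                      (fun k => Sum.elim (cmGramEntry L e' dV hdV (tensorFrame L dW eW dV') (tensorFrame_real L dW hdW eW dV' hdV')) (-cmGramEntry L e' dV hdV (tensorFrame L dW eW dV') (tensorFrame_real L dW hdW eW dV' hdV')) ((LocalSplitting.e₂ n').symm k))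
                      (imagUnit L) σ))).symm
                  (Equiv.refl (Fin (n' + n') × {v : {v : InfinitePlace (Fp L) // v.IsReal} // v ≠ σ})))))).trans
                (schwartzTransport (reindexCLE (Equiv.sumCongr
                  (dpIdxCongr
                    (PosIdx (signVec (cmPlaceOver L)
                      (fun k => Sum.elim (cmGramEntry L e' dV hdV (tensorFrame L dW eW dV') (tensorFrame_real L dW hdW eW dV' hdV')) (-cmGramEntry L e' dV hdV (tensorFrame L dW eW dV') (tensorFrame_real L dW hdW eW dV' hdV')) ((LocalSplitting.e₂ n').symm k))
                      (imagUnit L) σ))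
                    (NegIdx (signVec (cmPlaceOver L)
                      (fun k => Sum.elim (cmGramEntry L e' dV hdV (tensorFrame L dW eW dV') (tensorFrame_real L dW hdW eW dV' hdV')) (-cmGramEntry L e' dV hdV (tensorFrame L dW eW dV') (tensorFrame_real L dW hdW eW dV' hdV')) ((LocalSplitting.e₂ n').symm k))
                      (imagUnit L) σ))
                    Unit Empty ((P × R) ⊕ (Q × S)) ((P × S) ⊕ (Q × R)) Unit Empty eP eQ (Equiv.refl Unit) (Equiv.refl Empty)).symm
                  (Equiv.refl (Fin (n' + n') × {v : {v : InfinitePlace (Fp L) // v.IsReal} // v ≠ σ})))))) a = tensorPi ((schwartzTransport (reindexCLE (unitJunctionIdx ((P × R) ⊕ (Q × S)) ((P × S) ⊕ (Q × R))).symm)) Φ₁) Φ₂ →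
        swSection L e' dV hdV hdV0 (tensorFrame L dW eW dV') (tensorFrame_real L dW hdW eW dV' hdV') (tensorFrame_ne_zero L dW eW dV' hdW0 hdV'0) sB
            (piSchwartzBruhatEquiv (Fp L) (Fin (n' + n')) (a ⊗ₜ f))
            (H' * K2LiuArchOneParameterOrbitDefs.archEmb (Fp L) L (IsCMField.complexConj L) (n' + n')
              (hermD L e' dV hdV (tensorFrame L dW eW dV') (tensorFrame_real L dW hdW eW dV' hdV'))
              (placeSecJ L (IsCMField.complexConj L) (n' + n') (IsCMField.complexConj_ne_one L) (cmPlaceOver L) (cmPlaceOver_smul L) _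
                (gramD_gram_realDiagonal_entry_ne_zero L e' dV hdV (tensorFrame L dW eW dV') (tensorFrame_real L dW hdW eW dV' hdV') hdV0 (tensorFrame_ne_zero L dW eW dV' hdW0 hdV'0)) (complexConj_imagUnit L) (imagUnit_ne_zero L) σ
                (cmPlaceOver_comap L) (gramD_eq_diagonal_cm L e' dV hdV (tensorFrame L dW eW dV') (tensorFrame_real L dW hdW eW dV' hdV')) (J := hermD L e' dV hdV (tensorFrame L dW eW dV') (tensorFrame_real L dW hdW eW dV' hdV')) rfl
                (complexConj_smul_infinitePlace L) eP eQ ((toBig P Q R S g, (1 : UForm Unit Empty)) : Ginf ((P × R) ⊕ (Q × S)) ((P × S) ⊕ (Q × R)) Unit Empty))) =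
          (((etaD L e' dV hdV (tensorFrame L dW eW dV') (tensorFrame_real L dW hdW eW dV' hdV') t
              (placeSecJ L (IsCMField.complexConj L) (n' + n') (IsCMField.complexConj_ne_one L) (cmPlaceOver L) (cmPlaceOver_smul L) _
                (gramD_gram_realDiagonal_entry_ne_zero L e' dV hdV (tensorFrame L dW eW dV') (tensorFrame_real L dW hdW eW dV' hdV') hdV0 (tensorFrame_ne_zero L dW eW dV' hdW0 hdV'0)) (complexConj_imagUnit L) (imagUnit_ne_zero L) σ
                (cmPlaceOver_comap L) (gramD_eq_diagonal_cm L e' dV hdV (tensorFrame L dW eW dV') (tensorFrame_real L dW hdW eW dV' hdV')) (J := hermD L e' dV hdV (tensorFrame L dW eW dV') (tensorFrame_real L dW hdW eW dV' hdV')) rfl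
                (complexConj_smul_infinitePlace L) eP eQ ((toBig P Q R S g, (1 : UForm Unit Empty)) : Ginf ((P × R) ⊕ (Q × S)) ((P × S) ⊕ (Q × R)) Unit Empty)) : ℂˣ) : ℂ)) *
            ℓ' (tensorPi ((schwartzTransport (reindexCLE (unitJunctionIdx ((P × R) ⊕ (Q × S)) ((P × S) ⊕ (Q × R))).symm))
              ((weilRep (α := (P × R) ⊕ (Q × S)) (β := (P × S) ⊕ (Q × R))).comp (toBig P Q R S) g Φ₁)) Φ₂) := by
  obtain ⟨ℓ', hℓ'⟩ := exists_clm_swSection_tmul_mul_archEmb_placeSecJ L e' dV hdV hdV0 (tensorFrame L dW eW dV') (tensorFrame_real L dW hdW eW dV' hdV')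
    (tensorFrame_ne_zero L dW eW dV' hdW0 hdV'0) σ eP eQ hχu hχs hsB ht hodd H' f
  refine ⟨ℓ', fun g Φ₁ Φ₂ a ha => ?_⟩
  rw [hℓ' ((toBig P Q R S g, (1 : UForm Unit Empty)) : Ginf ((P × R) ⊕ (Q × S)) ((P × S) ⊕ (Q × R)) Unit Empty) a, ha,
    archSectionRepJ_placeSecJ_inl_tensorPi, weilRepPair_unit_toBig]

set_option maxHeartbeats 4000000 in
include hdW0 in
/-- **THE RIGHT LEG ON `K_H`**: for `k = (c, d) ∈ U(R) × U(S)` the big section at `H′ · (1_𝔻 ⊗ k)_σ` reads `κOp R S e (1, k)` in the `σ`-slot: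
`swSection sB (E(a ⊗ f)) (H′ · archEmb (placeSecJ_𝕎 σ (toBig (κ (1, k)), 1))) = η_t(…) · ℓ′((e_* (κOp R S e (1,k) Φ₁)) ⊠ Φ₂)`, `e = ⟨−|S|, −|R|, −|Q|, −|P|⟩` (§3 at `g = κ(1,k)` + §2) —
the arch pin the (E-d) pivot consumes. [cite: KonnoKonno2007, Lemma 5.2 p. 73] [cite: Folland1989, §4.2 Prop. (4.39)] [cite: Kudla1984, §1] -/
theorem exists_clm_swSection_mul_placeSecJ_kH_eq {χ : HeckeCharacter L} (hχu : χ.IsUnitary) (hχs : IsSplittingChar L 1 χ)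
    {sB : HA L e' dV hdV (tensorFrame L dW eW dV') (tensorFrame_real L dW hdW eW dV' hdV') →*
      MpD L e' dV hdV (tensorFrame L dW eW dV') (tensorFrame_real L dW hdW eW dV' hdV')}
    (hsB : IsDoubledWeilRep L e' dV hdV hdV0 (tensorFrame L dW eW dV') (tensorFrame_real L dW hdW eW dV' hdV')
      (tensorFrame_ne_zero L dW eW dV' hdW0 hdV'0) χ sB)
    {t : InfinitePlace L → ℤ} (ht : χ.HasUnitaryArchType t 0) (hodd : ∀ w, Odd (t w))
    (H' : HA L e' dV hdV (tensorFrame L dW eW dV') (tensorFrame_real L dW hdW eW dV' hdV')) (f : FinSB (Fp L) (Fin (n' + n'))) :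
    ∃ ℓ' : 𝓢(((DPIdx ((P × R) ⊕ (Q × S)) ((P × S) ⊕ (Q × R)) Unit Empty ⊕ (Fin (n' + n') × {v : {v : InfinitePlace (Fp L) // v.IsReal} // v ≠ σ})) → ℝ), ℂ) →L[ℂ] ℂ,
      ∀ (k : Matrix.unitaryGroup R ℂ × Matrix.unitaryGroup S ℂ) (Φ₁ : 𝓢((DPIdx P Q R S → ℝ), ℂ))
        (Φ₂ : 𝓢(((Fin (n' + n') × {v : {v : InfinitePlace (Fp L) // v.IsReal} // v ≠ σ}) → ℝ), ℂ))
        (a : 𝓢((Fin (n' + n') → mixedSpace (Fp L)), ℂ)),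
        ((((schwartzTransport
                  (scaledFrame (Fp L) (Fin (n' + n'))
                    (placeScale (n' + n') fun v => sqrtAbs (signVec (cmPlaceOver L)
                      (fun k => Sum.elim (cmGramEntry L e' dV hdV (tensorFrame L dW eW dV') (tensorFrame_real L dW hdW eW dV' hdV')) (-cmGramEntry L e' dV hdV (tensorFrame L dW eW dV') (tensorFrame_real L dW hdW eW dV' hdV')) ((LocalSplitting.e₂ n').symm k))
                      (imagUnit L) v))
                    (placeScale_ne_zero (n' + n') (sqrtAbs_signVec_ne_zero (IsCMField.complexConj_ne_one L) (cmPlaceOver_smul L)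
                      (complexConj_imagUnit L) (imagUnit_ne_zero L) (gramD_gram_realDiagonal_entry_ne_zero L e' dV hdV (tensorFrame L dW eW dV') (tensorFrame_real L dW hdW eW dV' hdV') hdV0 (tensorFrame_ne_zero L dW eW dV' hdW0 hdV'0)))))).trans
                (schwartzTransport (reindexCLE (placeSplitEquiv (signSplit (signVec (cmPlaceOver L)
                  (fun k => Sum.elim (cmGramEntry L e' dV hdV (tensorFrame L dW eW dV') (tensorFrame_real L dW hdW eW dV' hdV')) (-cmGramEntry L e' dV hdV (tensorFrame L dW eW dV') (tensorFrame_real L dW hdW eW dV' hdV')) ((LocalSplitting.e₂ n').symm k))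
                  (imagUnit L) σ)) σ)))).trans
                (schwartzTransport (reindexCLE (Equiv.sumCongr
                  (unitJunctionIdx
                    (PosIdx (signVec (cmPlaceOver L)
                      (fun k => Sum.elim (cmGramEntry L e' dV hdV (tensorFrame L dW eW dV') (tensorFrame_real L dW hdW eW dV' hdV')) (-cmGramEntry L e' dV hdV (tensorFrame L dW eW dV') (tensorFrame_real L dW hdW eW dV' hdV')) ((LocalSplitting.e₂ n').symm k))
                      (imagUnit L) σ))
                    (NegIdx (signVec (cmPlaceOver L)
                      (fun k => Sum.elim (cmGramEntry L e' dV hdV (tensorFrame L dW eW dV') (tensorFrame_real L dW hdW eW dV' hdV')) (-cmGramEntry L e' dV hdV (tensorFrame L dW eW dV') (tensorFrame_real L dW hdW eW dV' hdV')) ((LocalSplitting.e₂ n').symm k))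
                      (imagUnit L) σ))).symm
                  (Equiv.refl (Fin (n' + n') × {v : {v : InfinitePlace (Fp L) // v.IsReal} // v ≠ σ})))))).trans
                (schwartzTransport (reindexCLE (Equiv.sumCongr
                  (dpIdxCongr
                    (PosIdx (signVec (cmPlaceOver L)
                      (fun k => Sum.elim (cmGramEntry L e' dV hdV (tensorFrame L dW eW dV') (tensorFrame_real L dW hdW eW dV' hdV')) (-cmGramEntry L e' dV hdV (tensorFrame L dW eW dV') (tensorFrame_real L dW hdW eW dV' hdV')) ((LocalSplitting.e₂ n').symm k))
                      (imagUnit L) σ))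
                    (NegIdx (signVec (cmPlaceOver L)
                      (fun k => Sum.elim (cmGramEntry L e' dV hdV (tensorFrame L dW eW dV') (tensorFrame_real L dW hdW eW dV' hdV')) (-cmGramEntry L e' dV hdV (tensorFrame L dW eW dV') (tensorFrame_real L dW hdW eW dV' hdV')) ((LocalSplitting.e₂ n').symm k))
                      (imagUnit L) σ))
                    Unit Empty ((P × R) ⊕ (Q × S)) ((P × S) ⊕ (Q × R)) Unit Empty eP eQ (Equiv.refl Unit) (Equiv.refl Empty)).symm
                  (Equiv.refl (Fin (n' + n') × {v : {v : InfinitePlace (Fp L) // v.IsReal} // v ≠ σ})))))) a = tensorPi ((schwartzTransport (reindexCLE (unitJunctionIdx ((P × R) ⊕ (Q × S)) ((P × S) ⊕ (Q × R))).symm)) Φ₁) Φ₂ →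
        swSection L e' dV hdV hdV0 (tensorFrame L dW eW dV') (tensorFrame_real L dW hdW eW dV' hdV') (tensorFrame_ne_zero L dW eW dV' hdW0 hdV'0) sB
            (piSchwartzBruhatEquiv (Fp L) (Fin (n' + n')) (a ⊗ₜ f))
            (H' * K2LiuArchOneParameterOrbitDefs.archEmb (Fp L) L (IsCMField.complexConj L) (n' + n')
              (hermD L e' dV hdV (tensorFrame L dW eW dV') (tensorFrame_real L dW hdW eW dV' hdV'))
              (placeSecJ L (IsCMField.complexConj L) (n' + n') (IsCMField.complexConj_ne_one L) (cmPlaceOver L) (cmPlaceOver_smul L) _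
                (gramD_gram_realDiagonal_entry_ne_zero L e' dV hdV (tensorFrame L dW eW dV') (tensorFrame_real L dW hdW eW dV' hdV') hdV0 (tensorFrame_ne_zero L dW eW dV' hdW0 hdV'0)) (complexConj_imagUnit L) (imagUnit_ne_zero L) σ
                (cmPlaceOver_comap L) (gramD_eq_diagonal_cm L e' dV hdV (tensorFrame L dW eW dV') (tensorFrame_real L dW hdW eW dV' hdV')) (J := hermD L e' dV hdV (tensorFrame L dW eW dV') (tensorFrame_real L dW hdW eW dV' hdV')) rfl
                (complexConj_smul_infinitePlace L) eP eQ ((toBig P Q R S (κ P Q R S ((1 : Matrix.unitaryGroup P ℂ × Matrix.unitaryGroup Q ℂ), k)), (1 : UForm Unit Empty)) : Ginf ((P × R) ⊕ (Q × S)) ((P × S) ⊕ (Q × R)) Unit Empty))) =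
          (((etaD L e' dV hdV (tensorFrame L dW eW dV') (tensorFrame_real L dW hdW eW dV' hdV') t
              (placeSecJ L (IsCMField.complexConj L) (n' + n') (IsCMField.complexConj_ne_one L) (cmPlaceOver L) (cmPlaceOver_smul L) _
                (gramD_gram_realDiagonal_entry_ne_zero L e' dV hdV (tensorFrame L dW eW dV') (tensorFrame_real L dW hdW eW dV' hdV') hdV0 (tensorFrame_ne_zero L dW eW dV' hdW0 hdV'0)) (complexConj_imagUnit L) (imagUnit_ne_zero L) σ
                (cmPlaceOver_comap L) (gramD_eq_diagonal_cm L e' dV hdV (tensorFrame L dW eW dV') (tensorFrame_real L dW hdW eW dV' hdV')) (J := hermD L e' dV hdV (tensorFrame L dW eW dV') (tensorFrame_real L dW hdW eW dV' hdV')) rfl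
                (complexConj_smul_infinitePlace L) eP eQ ((toBig P Q R S (κ P Q R S ((1 : Matrix.unitaryGroup P ℂ × Matrix.unitaryGroup Q ℂ), k)), (1 : UForm Unit Empty)) : Ginf ((P × R) ⊕ (Q × S)) ((P × S) ⊕ (Q × R)) Unit Empty)) : ℂˣ) : ℂ)) *
            ℓ' (tensorPi ((schwartzTransport (reindexCLE (unitJunctionIdx ((P × R) ⊕ (Q × S)) ((P × S) ⊕ (Q × R))).symm))
              (κOp R S (⟨-(Fintype.card S : ℤ), -(Fintype.card R : ℤ), -(Fintype.card Q : ℤ), -(Fintype.card P : ℤ)⟩ : VacExponents)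
                (((1 : Matrix.unitaryGroup P ℂ × Matrix.unitaryGroup Q ℂ), k) : DPK P Q R S) Φ₁)) Φ₂) := by
  obtain ⟨ℓ', hℓ'⟩ := exists_clm_swSection_mul_placeSecJ_pair_eq L dV hdV hdV0 dW hdW hdW0 eW e' dV' hdV' hdV'0 σ eP eQ hχu hχs hsB ht hodd H' f
  refine ⟨ℓ', fun k Φ₁ Φ₂ a ha => ?_⟩
  rw [hℓ' (κ P Q R S ((1 : Matrix.unitaryGroup P ℂ × Matrix.unitaryGroup Q ℂ), k)) Φ₁ Φ₂ a ha, weilRepPair_κ_eq_κOp]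

end Pin

end Summit.HodgeConjecture.HodgeConjecture.Cruxes.HLiu418.K2LiuArchRightLegPlacePin

end
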